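import Literature.NumberTheory.Sieve.ParityWave0
import Literature.NumberTheory.Sieve.LargeSieveInequality
import HarnessLib

/-!
# The large sieve inequality with the sharp constant `Q² + N − 1` (proof)

Topic `Literature/NumberTheory/Sieve`, companion ("Proofs") file of `ParityWave0.lean`, kept
separate so that the statement file keeps its imports and its review queue. It discharges the
named fact `Literature.NumberTheory.Sieve.large_sieve_inequality` (parity.S33): for complex `a_n` supported on
`M < n ≤ M + N`,

  `∑_{q ≤ Q} ∑_{b mod q, (b,q)=1} |∑_n a_n e(bn/q)|² ≤ (Q² + N − 1) ∑_n |a_n|²`,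

as `Literature.NumberTheory.Sieve.large_sieve_inequality_holds`, with complete proofs (no `sorry`, no new axioms).
On the way it proves the general **analytic large sieve inequality for `δ`-spaced points with
Selberg's constant `N − 1 + δ⁻¹`** (`largeSieve_sharp`), of which parity.S33 is the case of the
Farey points of order `Q` (`δ = Q⁻²`).

## Sources and what is cited where

* H. L. Montgomery, *The analytic principle of the large sieve*, Bull. Amer. Math. Soc. **84**
  (1978), 547–567 [Montgomery1978] — the text this file follows:
  §4, Lemma 2, p. 550 (duality, case `p₁ = p₂ = 2`) → `duality`;
  §6, Theorem 2, p. 554 (Montgomery–Vaughan's generalised Hilbert inequality, with its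
  extremal-eigenvector proof) and Corollary 1, p. 556 (the periodic / cosecant form)
  → `mv_core`, `hilbert_inequality`;
  Corollary 2, p. 556 (the large sieve with `Δ = N + δ⁻¹`, i.e. Montgomery–Vaughan 1973, Thm 1)
  → `largeSieve_dual`, `largeSieve_weak`;
  §7, Theorem 3 (Selberg), p. 559, `Δ = N − 1 + δ⁻¹`, proved here by the *Note added in proof*,
  p. 559 (Paul Cohen's dilation trick: apply Corollary 2 to `T(α) = S(Kα)` at the points
  `(α_r + k)/K`, `0 ≤ k < K`, which are `δ/K`-spaced, divide by `K`, let `K → ∞`)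
  → `sep_dilate`, `largeSieve_sharp`;
  §8, eq. (20), p. 559 (the Farey points `a/q`, `q ≤ Q`, `(a, q) = 1` are `Q⁻²`-spaced)
  → `Literature.NumberTheory.Sieve.LargeSieve.farey_spacing` (reused from `LargeSieveInequality.lean`),
  `Literature.NumberTheory.Sieve.large_sieve_inequality_holds`.
* H. L. Montgomery, R. C. Vaughan, *The large sieve*, Mathematika **20** (1973), 119–134
  [MontgomeryVaughanMathematika1973], Theorem 1: `Δ = N + δ⁻¹` (the cite carried by the named
  fact). **Cite precision.** The constant `Q² + N − 1` of parity.S33 is `N − 1 + δ⁻¹` at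
  `δ = Q⁻²`, i.e. Selberg's sharpening (Montgomery 1978, Thm 3; Iwaniec–Kowalski, *Analytic Number
  Theory*, Thm 7.7 and Thm 7.11, the second cite carried by the fact), which is `1` better than
  Montgomery–Vaughan 1973, Thm 1 verbatim (`Q² + N`). The vendored statement is therefore exactly
  Iwaniec–Kowalski Thm 7.11 / Montgomery 1978 Thm 3 + (20); it is proved here as stated, not
  weakened, and it is not mis-stated.

## The argument

* **Trigonometric sums** (`geom_sum_e`): `e(t) = exp(2πit)` and the closed form
  `2i sin(πθ) ∑_{M<n≤M+N} e(nθ) = e((M+N+½)θ) − e((M+½)θ)`.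
* **Spacing** (`spacing_pos`, `spacing_sum_le`, `sum_cosecK_sq_le`): if the `x_r` are `δ`-spaced
  modulo `1` then, for each `s`, `∑_{t ≠ s} 1/sin²(π(x_s − x_t)) ≤ δ⁻²/3 + δ⁻¹`, from
  `1/sin² u ≤ 1/u² + 1` (`|u| ≤ π/2`), the `k`-th smallest positive representative being `≥ kδ`,
  and `∑ k⁻² ≤ π²/6` (Mathlib's `hasSum_zeta_two`).
* **Montgomery–Vaughan's eigenvector argument** (`mv_core`, `abs_re_quadForm_le`,
  `hilbert_inequality`; Montgomery 1978, proof of Thm 2): the matrix `i K`, `K_{rs} =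
  cosec π(x_r − x_s)` (`r ≠ s`), is Hermitian; for an eigenvector `v` with eigenvalue `μ` one
  expands `∑_r |∑_s K_{rs} v_s|²` using the identity
  `cosec a · cosec b = cosec(a − b)(cot b − cot a)` (`cosecK_mul_cosecK`), the antisymmetry of
  `cot`, and `|cosec · cot| ≤ cosec²` to get `μ² ≤ 3 · max_s ∑_t K_{st}²`, whence (spectral
  theorem, via `Matrix.PosSemidef`) `|∑_{r,s} w_r w̄_s K_{rs}| ≤ (δ⁻¹ + 3/2) ∑ |w_r|²`. The crude
  constant `δ⁻¹ + 3/2` (Montgomery–Vaughan prove `δ⁻¹`) costs nothing below.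
* **Dual form and duality** (`largeSieve_dual`, `duality`, `largeSieve_weak`; Montgomery 1978,
  (6)–(8) and Cor 2): expanding `∑_{M<n≤M+N} |∑_r c_r e(n x_r)|²` and summing the geometric series
  gives `N ∑|c_r|²` plus two bilinear forms in the cosecant kernel, so the dual inequality holds
  with `Δ = N + δ⁻¹ + 3/2`, and by duality so does the large sieve itself.
* **Cohen's dilation** (`sep_dilate`, `largeSieve_sharp`; Montgomery 1978, p. 559, note added in
  proof): applied to the `δ/K`-spaced points `(x_r + k)/K` and the frequencies `nK`, which lie in
  an interval of length `K(N − 1) + 1`, the weak inequality gives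
  `K Σ ≤ (K(N − 1) + 1 + Kδ⁻¹ + 3/2) ∑|a_n|²`; divide by `K` and let `K → ∞`:
  `Δ = N − 1 + δ⁻¹` (for `δ ≤ 1`, `N ≥ 1`).
* **Farey points** (`Literature.NumberTheory.Sieve.LargeSieve.farey_spacing`; Montgomery 1978, (20)): for `b/q ≠ b'/q'` reduced with
  `q, q' ≤ Q`, `|b/q − b'/q' − m| ≥ 1/(qq') ≥ Q⁻²` for every integer `m`; with `δ = Q⁻²` this is
  parity.S33 (the cases `N = 0`, `Q = 0` being trivial).

## Design

* `e t` is `Literature.Parity.LargeSieve.e t = (𝐞 t : ℂ)` (Mathlib's additive character `Real.fourierChar`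
  coerced to `ℂ`) from `LargeSieveInequality.lean`; that file proves the weaker constant
  `N + 1 + 2δ⁻¹` by Bombieri's method, and this file reuses (rather than duplicates) its small `e`-API,
  its one-sided spacing lemmas `card_mul_le_max_of_separated` /
  `sum_inv_sq_le_sum_range_of_separated`, and `farey_spacing`; nothing else of it is used.
  Everything is a finite sum; the only analysis used is `sin u > u − u³/6`, `ζ(2) = π²/6` and the
  spectral theorem for Hermitian matrices (all from Mathlib).
* All new auxiliary declarations live in the namespace `Literature.Parity.LargeSieveMV` (the only new
  definitions are the kernels `cosecK`, `cotK`); the discharge itself is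
  `Literature.NumberTheory.Sieve.large_sieve_inequality_holds`. Axioms: `propext`, `Classical.choice`, `Quot.sound`.

## References

* H. L. Montgomery, *The analytic principle of the large sieve*, Bull. Amer. Math. Soc. 84 (1978),
  547–567. [Montgomery1978]
* H. L. Montgomery, R. C. Vaughan, *The large sieve*, Mathematika 20 (1973), 119–134.
  [MontgomeryVaughanMathematika1973]
* H. Iwaniec, E. Kowalski, *Analytic Number Theory*, AMS Colloquium Publ. 53 (2004), Thm 7.7,
  Thm 7.11. [IwaniecKowalski2004]
-/

open Finset Complex Matrix
open scoped Real ComplexConjugate ComplexOrder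

namespace Literature.NumberTheory.Sieve.LargeSieveMV

open LargeSieve (e e_eq_exp e_add norm_e e_zero e_int conj_e e_sub e_add_int e_mul_conj card_mul_le_max_of_separated sum_inv_sq_le_sum_range_of_separated)

/-! ### Geometric sums of `e(nθ)` (`e = Literature.Parity.LargeSieve.e`, Mathlib's `𝐞` coerced to `ℂ`) -/

/-- `e(s) = e(t)` whenever `s − t` is an integer (`e` is `Literature.NumberTheory.Sieve.LargeSieve.e`, Mathlib's additive
character `𝐞` coerced to `ℂ`). [folklore] -/
theorem e_eq_of_sub_eq_int {s t : ℝ} (n : ℤ) (h : s - t = n) : e s = e t := by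
  rw [show s = t + n by linarith, e_add_int]

/-- `e(θ/2) − e(−θ/2) = 2i sin(πθ)`. [folklore] -/
theorem e_half_sub (θ : ℝ) : e (θ / 2) - e (-(θ / 2)) = 2 * I * (Real.sin (π * θ) : ℂ) := by
  rw [e_eq_exp, e_eq_exp, Complex.ofReal_sin, Complex.sin]
  have h1 : (I * ((2 * π * (θ / 2) : ℝ) : ℂ)) = (π * θ : ℝ) * I := by push_cast; ring
  have h2 : (I * ((2 * π * (-(θ / 2)) : ℝ) : ℂ)) = -((π * θ : ℝ) : ℂ) * I := by push_cast; ring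
  rw [h1, h2]
  ring_nf
  rw [Complex.I_sq]
  ring

/-- Geometric sum in closed form: `2i sin(πθ) ∑_{M < n ≤ M+N} e(nθ) = e((M+N+½)θ) − e((M+½)θ)`
(valid for all `θ`; both sides vanish when `θ ∈ ℤ`). [cite: Montgomery1978, §4, p. 551, the derivation of (6)] -/
theorem geom_sum_e (M : ℤ) (N : ℕ) (θ : ℝ) :
    2 * I * (Real.sin (π * θ) : ℂ) * ∑ n ∈ Ioc M (M + N), e (n * θ) =
      e (((M : ℝ) + N + 1 / 2) * θ) - e (((M : ℝ) + 1 / 2) * θ) := by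
  induction N with
  | zero => simp
  | succ N ih =>
    have hIoc : Ioc M (M + (N + 1 : ℕ)) = insert (M + N + 1) (Ioc M (M + N)) := by
      ext n; simp only [mem_Ioc, mem_insert]; push_cast; omega
    have hnot : (M + N + 1) ∉ Ioc M (M + N) := by simp
    rw [hIoc, sum_insert hnot, mul_add, ih, ← e_half_sub, sub_mul, ← e_add, ← e_add]
    push_cast
    ring_nf


/-- For `0 < u ≤ π/2`: `1/sin² u ≤ 1/u² + 1` (from `sin u > u − u³/6`). [folklore] -/
theorem one_div_sin_sq_le_pos {u : ℝ} (hu : 0 < u) (hu' : u ≤ π / 2) :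
    1 / Real.sin u ^ 2 ≤ 1 / u ^ 2 + 1 := by
  have hpi := Real.pi_lt_d2
  have hu2 : u ^ 2 < 3 := by nlinarith
  have hs : u - u ^ 3 / 6 < Real.sin u := Real.sin_gt_sub_cube hu
  have hpos : 0 < u - u ^ 3 / 6 := by nlinarith
  have hsin : 0 < Real.sin u := lt_trans hpos hs
  have hsq : (u - u ^ 3 / 6) ^ 2 ≤ Real.sin u ^ 2 := by
    exact pow_le_pow_left₀ hpos.le hs.le 2
  have key : u ^ 2 ≤ (1 + u ^ 2) * (u - u ^ 3 / 6) ^ 2 := by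
    have h36 : (1 + u ^ 2) * (u - u ^ 3 / 6) ^ 2 - u ^ 2
        = u ^ 2 * (u ^ 2 * (24 - 11 * u ^ 2 + u ^ 4)) / 36 := by ring
    have : 0 ≤ u ^ 2 * (u ^ 2 * (24 - 11 * u ^ 2 + u ^ 4)) / 36 := by
      have h1 : 0 ≤ 24 - 11 * u ^ 2 + u ^ 4 := by nlinarith
      positivity
    linarith
  have key2 : u ^ 2 ≤ (1 + u ^ 2) * Real.sin u ^ 2 :=
    key.trans (mul_le_mul_of_nonneg_left hsq (by positivity))
  rw [div_add_one (by positivity), div_le_div_iff₀ (by positivity) (by positivity), one_mul]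
  linarith

/-- For `u ≠ 0`, `|u| ≤ π/2`: `1/sin² u ≤ 1/u² + 1`. [folklore] -/
theorem one_div_sin_sq_le {u : ℝ} (hu : u ≠ 0) (hu' : |u| ≤ π / 2) :
    1 / Real.sin u ^ 2 ≤ 1 / u ^ 2 + 1 := by
  rcases lt_or_gt_of_ne hu with h | h
  · have := one_div_sin_sq_le_pos (u := -u) (by linarith) (by rwa [abs_of_neg h] at hu')
    simpa [Real.sin_neg] using this
  · exact one_div_sin_sq_le_pos h (by rwa [abs_of_pos h] at hu')

/-- Partial sums of `∑_{k ≥ 0} 1/(k+1)²` are at most `ζ(2) = π²/6`. [folklore] -/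
theorem sum_range_one_div_succ_sq_le (n : ℕ) :
    ∑ k ∈ range n, 1 / ((k : ℝ) + 1) ^ 2 ≤ π ^ 2 / 6 := by
  have h := sum_le_hasSum (range (n + 1)) (fun i _ => by positivity) hasSum_zeta_two
  rw [Finset.sum_range_succ'] at h
  simpa using h

/-- One-sided spacing lemma: if a finite set `P` of reals `≥ δ` is pairwise `δ`-separated, then its
`k`-th smallest element is `≥ kδ`, so `∑_{e ∈ P} e⁻² ≤ δ⁻² ∑_{k < #P} (k+1)⁻²` and `max P ≥ #P · δ`.
Both conjuncts are repackagings of `Literature.NumberTheory.Sieve.LargeSieve.sum_inv_sq_le_sum_range_of_separated` and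
`Literature.NumberTheory.Sieve.LargeSieve.card_mul_le_max_of_separated` (`LargeSieveInequality.lean`).
[cite: Montgomery1978, §6, proof of Cor 1 (the points being well spaced)] -/
theorem spacing_pos (δ : ℝ) (hδ : 0 < δ) (P : Finset ℝ) (h1 : ∀ e ∈ P, δ ≤ e)
    (h2 : ∀ e ∈ P, ∀ e' ∈ P, e ≠ e' → δ ≤ |e - e'|) :
    (∑ e ∈ P, 1 / e ^ 2 ≤ δ⁻¹ ^ 2 * ∑ k ∈ range P.card, 1 / ((k : ℝ) + 1) ^ 2) ∧
      (∀ e ∈ P, (∀ e' ∈ P, e' ≤ e) → P.card * δ ≤ e) := by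
  refine ⟨?_, fun e he hmax => ?_⟩
  · calc ∑ e ∈ P, 1 / e ^ 2 = ∑ t ∈ P, (t ^ 2)⁻¹ := by simp only [one_div]
      _ ≤ ∑ k ∈ range #P, ((((k + 1 : ℕ) : ℝ) * δ) ^ 2)⁻¹ :=
          sum_inv_sq_le_sum_range_of_separated hδ P h1 h2
      _ = δ⁻¹ ^ 2 * ∑ k ∈ range P.card, 1 / ((k : ℝ) + 1) ^ 2 := by
          rw [Finset.mul_sum]
          refine Finset.sum_congr rfl fun k _ => ?_
          push_cast
          rw [mul_pow, mul_inv, one_div, inv_pow, mul_comm]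
  · have hne : P.Nonempty := ⟨e, he⟩
    have hm : P.max' hne = e := le_antisymm (Finset.max'_le _ _ _ hmax) (Finset.le_max' _ _ he)
    have h := card_mul_le_max_of_separated P h1 h2 hne
    rwa [hm] at h

/-- Two-sided spacing lemma: a pairwise `δ`-separated finite set `E ⊆ [−½, ½]` with `|e| ≥ δ` on `E`
has `∑_{e ∈ E} e⁻² ≤ (π²/3) δ⁻²` and `#E ≤ δ⁻¹`. [cite: Montgomery1978, §6, proof of Cor 1] -/
theorem spacing_sum_le (δ : ℝ) (hδ : 0 < δ) (E : Finset ℝ) (h1 : ∀ e ∈ E, δ ≤ |e|)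
    (h2 : ∀ e ∈ E, ∀ e' ∈ E, e ≠ e' → δ ≤ |e - e'|) (h3 : ∀ e ∈ E, |e| ≤ 1 / 2) :
    ∑ e ∈ E, 1 / e ^ 2 ≤ π ^ 2 / 3 * δ⁻¹ ^ 2 ∧ (E.card : ℝ) ≤ δ⁻¹ := by
  classical
  set P := E.filter (fun e => 0 < e) with hP
  set Nn := E.filter (fun e => e < 0) with hNn
  have hE : E = P ∪ Nn := by
    ext e
    simp only [hP, hNn, mem_union, mem_filter]
    constructor
    · intro he
      have hne : e ≠ 0 := by
        intro h0; have := h1 e he; rw [h0, abs_zero] at this; linarith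
      rcases lt_or_gt_of_ne hne with h | h
      · exact Or.inr ⟨he, h⟩
      · exact Or.inl ⟨he, h⟩
    · rintro (⟨he, _⟩ | ⟨he, _⟩) <;> exact he
  have hdisj : Disjoint P Nn := by
    rw [hP, hNn, disjoint_filter]; intro e _ h; linarith
  -- positive part
  have hP1 : ∀ e ∈ P, δ ≤ e := by
    intro e he; rw [hP, mem_filter] at he
    have := h1 e he.1; rwa [abs_of_pos he.2] at this
  have hP2 : ∀ e ∈ P, ∀ e' ∈ P, e ≠ e' → δ ≤ |e - e'| := fun e he e' he' hne =>
    h2 e (mem_of_mem_filter e he) e' (mem_of_mem_filter e' he') hne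
  obtain ⟨hPs, hPc⟩ := spacing_pos δ hδ P hP1 hP2
  -- negative part, reflected
  set Q := Nn.image (fun e => -e) with hQ
  have hQ1 : ∀ e ∈ Q, δ ≤ e := by
    intro e he; rw [hQ, mem_image] at he
    obtain ⟨f, hf, rfl⟩ := he
    rw [hNn, mem_filter] at hf
    have := h1 f hf.1; rwa [abs_of_neg hf.2] at this
  have hQ2 : ∀ e ∈ Q, ∀ e' ∈ Q, e ≠ e' → δ ≤ |e - e'| := by
    intro e he e' he' hne
    rw [hQ, mem_image] at he he'
    obtain ⟨f, hf, rfl⟩ := he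
    obtain ⟨f', hf', rfl⟩ := he'
    have := h2 f (mem_of_mem_filter f hf) f' (mem_of_mem_filter f' hf') (fun h => hne (by rw [h]))
    rwa [show -f - -f' = -(f - f') by ring, abs_neg]
  obtain ⟨hQs, hQc⟩ := spacing_pos δ hδ Q hQ1 hQ2
  have hinj : Set.InjOn (fun e : ℝ => -e) Nn := fun a _ b _ h => neg_injective h
  have hQcard : Q.card = Nn.card := card_image_of_injOn hinj
  have hQsum : ∑ e ∈ Q, 1 / e ^ 2 = ∑ e ∈ Nn, 1 / e ^ 2 := by
    rw [hQ, sum_image hinj]; simp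
  -- card bounds
  have hPcard : (P.card : ℝ) * δ ≤ 1 / 2 := by
    rcases P.eq_empty_or_nonempty with hp | hp
    · simp [hp]
    · have hm := P.max'_mem hp
      exact (hPc _ hm (fun e' he' => P.le_max' e' he')).trans
        ((le_abs_self _).trans (h3 _ (mem_of_mem_filter _ hm)))
  have hQcard' : (Q.card : ℝ) * δ ≤ 1 / 2 := by
    rcases Q.eq_empty_or_nonempty with hq | hq
    · simp [hq]
    · have hm := Q.max'_mem hq
      have hm' : Q.max' hq ∈ Nn.image (fun e => -e) := hm
      rw [mem_image] at hm'
      obtain ⟨f, hf, hfeq⟩ := hm'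
      refine (hQc _ hm (fun e' he' => Q.le_max' e' he')).trans ?_
      rw [← hfeq]
      exact (le_abs_self _).trans (by rw [abs_neg]; exact h3 _ (mem_of_mem_filter _ hf))
  refine ⟨?_, ?_⟩
  · rw [hE, sum_union hdisj, ← hQsum]
    have h6P := sum_range_one_div_succ_sq_le P.card
    have h6Q := sum_range_one_div_succ_sq_le Q.card
    have hδ2 : 0 ≤ δ⁻¹ ^ 2 := by positivity
    nlinarith [mul_le_mul_of_nonneg_left h6P hδ2, mul_le_mul_of_nonneg_left h6Q hδ2]
  · rw [hE, card_union_of_disjoint hdisj, ← hQcard]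
    push_cast
    rw [← le_div_iff₀ hδ] at hPcard hQcard'
    have : 1 / 2 / δ + 1 / 2 / δ = δ⁻¹ := by field_simp; ring
    linarith


/-- **Montgomery–Vaughan's extremal-eigenvector computation**, abstract kernel form. Let `K`, `G` be
real antisymmetric kernels on a finite index set with `K_{rs} K_{rt} = K_{ts}(G_{rt} − G_{rs})` for
distinct `r, s, t`, `|K_{ts} G_{st}| ≤ K_{st}²`, and row sums `∑_t K_{st}² ≤ S`. If `K v = iμ v` then
`μ² ‖v‖² ≤ 3S ‖v‖²`. (In the application `K = cosec`, `G = cot`.)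
[cite: Montgomery1978, §6, proof of Thm 2, pp. 554–556] -/
theorem mv_core {ι : Type*} [Fintype ι] [DecidableEq ι] (K G : ι → ι → ℝ)
    (hK : ∀ r s, K s r = -K r s) (hG : ∀ r s, G s r = -G r s)
    (hKG : ∀ r s t, r ≠ s → r ≠ t → s ≠ t → K r s * K r t = K t s * (G r t - G r s))
    (hbd : ∀ s t, |K t s * G s t| ≤ K s t ^ 2)
    (S : ℝ) (hS : ∀ s, ∑ t, K s t ^ 2 ≤ S)
    (μ : ℝ) (v : ι → ℂ) (hv : ∀ r, ∑ s, (K r s : ℂ) * v s = I * μ * v r) :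
    μ ^ 2 * ∑ r, ‖v r‖ ^ 2 ≤ 3 * S * ∑ r, ‖v r‖ ^ 2 := by
  have hKrr : ∀ r, K r r = 0 := fun r => by have := hK r r; linarith
  have hGrr : ∀ r, G r r = 0 := fun r => by have := hG r r; linarith
  have hK2 : ∀ r s, K s r ^ 2 = K r s ^ 2 := fun r s => by rw [hK r s, neg_sq]
  set τ : ι → ℝ := fun t => ∑ r, G r t with hτ
  set D : ι → ℝ := fun s => ∑ r, K r s ^ 2 with hD
  -- the kernel identity
  have hP : ∀ s t, ∑ r, K r s * K r t =
      (if s = t then D s else 0) + K t s * (τ t - τ s) - 2 * (K t s * G s t) := by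
    intro s t
    by_cases hst : s = t
    · subst hst; simp [hKrr, hD, pow_two]
    · rw [if_neg hst, zero_add]
      have h1 : ∑ r, (K r s * K r t - K t s * (G r t - G r s)) = -(2 * (K t s * G s t)) := by
        rw [Fintype.sum_eq_add s t hst]
        · rw [hKrr s, hKrr t, hGrr s, hGrr t, hG s t]; ring
        · intro r ⟨hrs, hrt⟩
          rw [hKG r s t hrs hrt hst]; ring
      have h2 : ∑ r, K t s * (G r t - G r s) = K t s * (τ t - τ s) := by
        rw [hτ, ← Finset.mul_sum, Finset.sum_sub_distrib]
      rw [Finset.sum_sub_distrib, h2] at h1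
      linarith
  -- conj of the eigen-equation
  have hvc : ∀ r, ∑ s, (K r s : ℂ) * conj (v s) = -(I * μ * conj (v r)) := by
    intro r
    have h := congrArg conj (hv r)
    rw [map_sum] at h
    simp only [map_mul, Complex.conj_ofReal, Complex.conj_I] at h
    rw [h]; ring
  set A : ι → ℂ := fun r => ∑ s, (K r s : ℂ) * v s with hA
  have hAc : ∀ r, conj (A r) = ∑ s, (K r s : ℂ) * conj (v s) := by
    intro r; simp only [hA, map_sum, map_mul, Complex.conj_ofReal]
  -- Z computed from the eigen-equation
  have hZ1 : ∑ r, A r * conj (A r) = ((μ ^ 2 * ∑ r, ‖v r‖ ^ 2 : ℝ) : ℂ) := by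
    push_cast
    rw [Finset.mul_sum]
    refine Finset.sum_congr rfl fun r _ => ?_
    rw [Complex.mul_conj, Complex.normSq_eq_norm_sq]
    have : A r = I * μ * v r := hv r
    rw [this, norm_mul, norm_mul, Complex.norm_I, one_mul, Complex.norm_real, Real.norm_eq_abs,
      mul_pow, sq_abs]
    push_cast
    ring
  -- Z expanded
  have hZ2 : ∑ r, A r * conj (A r) =
      ∑ s, ∑ t, v s * conj (v t) * ((∑ r, K r s * K r t : ℝ) : ℂ) := by
    calc ∑ r, A r * conj (A r)
        = ∑ r, ∑ s, ∑ t, ((K r s : ℂ) * v s) * ((K r t : ℂ) * conj (v t)) := by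
          refine Finset.sum_congr rfl fun r _ => ?_
          rw [hAc r, hA]; simp only
          rw [Finset.sum_mul_sum]
      _ = ∑ s, ∑ r, ∑ t, ((K r s : ℂ) * v s) * ((K r t : ℂ) * conj (v t)) := Finset.sum_comm
      _ = ∑ s, ∑ t, ∑ r, ((K r s : ℂ) * v s) * ((K r t : ℂ) * conj (v t)) := by
          refine Finset.sum_congr rfl fun s _ => Finset.sum_comm
      _ = ∑ s, ∑ t, v s * conj (v t) * ((∑ r, K r s * K r t : ℝ) : ℂ) := by
          refine Finset.sum_congr rfl fun s _ => Finset.sum_congr rfl fun t _ => ?_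
          push_cast
          rw [Finset.mul_sum]
          refine Finset.sum_congr rfl fun r _ => ?_
          ring
  -- substitute the kernel identity
  set W : ℂ := ∑ s, ∑ t, v s * conj (v t) * ((K t s * G s t : ℝ) : ℂ) with hW
  have hZ3 : ∑ s, ∑ t, v s * conj (v t) * ((∑ r, K r s * K r t : ℝ) : ℂ) =
      ((∑ s, ‖v s‖ ^ 2 * D s : ℝ) : ℂ) + 0 - 2 * W := by
    have hsplit : ∀ s t, v s * conj (v t) * ((∑ r, K r s * K r t : ℝ) : ℂ) =
        v s * conj (v t) * ((if s = t then D s else 0 : ℝ) : ℂ)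
        + (conj (v t) * τ t * ((K t s : ℂ) * v s) - v s * τ s * ((K t s : ℂ) * conj (v t)))
        - 2 * (v s * conj (v t) * ((K t s * G s t : ℝ) : ℂ)) := by
      intro s t
      rw [hP s t]; push_cast; ring
    simp_rw [hsplit, Finset.sum_sub_distrib, Finset.sum_add_distrib]
    congr 1; congr 1
    · -- diagonal
      push_cast
      refine Finset.sum_congr rfl fun s _ => ?_
      rw [Fintype.sum_eq_single s]
      · rw [if_pos rfl, Complex.mul_conj, Complex.normSq_eq_norm_sq]; push_cast; ring
      · intro t hts
        rw [if_neg (Ne.symm hts)]; simp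
    · -- middle term vanishes
      simp only [Finset.sum_sub_distrib]
      have e1 : ∑ s, ∑ t, conj (v t) * τ t * ((K t s : ℂ) * v s)
          = ∑ t, conj (v t) * τ t * (I * μ * v t) := by
        rw [Finset.sum_comm]
        refine Finset.sum_congr rfl fun t _ => ?_
        rw [← Finset.mul_sum, hv t]
      have e2 : ∑ s, ∑ t, v s * τ s * ((K t s : ℂ) * conj (v t))
          = ∑ s, v s * τ s * (I * μ * conj (v s)) := by
        refine Finset.sum_congr rfl fun s _ => ?_
        rw [← Finset.mul_sum]
        congr 1
        have : ∑ t, (K t s : ℂ) * conj (v t) = -∑ t, (K s t : ℂ) * conj (v t) := by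
          rw [← Finset.sum_neg_distrib]
          refine Finset.sum_congr rfl fun t _ => ?_
          rw [hK s t]; push_cast; ring
        rw [this, hvc s]; ring
      rw [e1, e2, ← Finset.sum_sub_distrib]
      refine Finset.sum_eq_zero fun t _ => ?_
      ring
    · rw [hW, Finset.mul_sum]
      refine Finset.sum_congr rfl fun s _ => ?_
      rw [Finset.mul_sum]
  -- bound on W
  have hWbd : ‖W‖ ≤ S * ∑ r, ‖v r‖ ^ 2 := by
    calc ‖W‖ ≤ ∑ s, ‖∑ t, v s * conj (v t) * ((K t s * G s t : ℝ) : ℂ)‖ := norm_sum_le _ _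
      _ ≤ ∑ s, ∑ t, ‖v s‖ * ‖v t‖ * K s t ^ 2 := by
          refine Finset.sum_le_sum fun s _ => (norm_sum_le _ _).trans (Finset.sum_le_sum fun t _ => ?_)
          rw [norm_mul, norm_mul, Complex.norm_conj, Complex.norm_real, Real.norm_eq_abs]
          exact mul_le_mul_of_nonneg_left (hbd s t) (by positivity)
      _ ≤ ∑ s, ∑ t, (‖v s‖ ^ 2 + ‖v t‖ ^ 2) / 2 * K s t ^ 2 := by
          refine Finset.sum_le_sum fun s _ => Finset.sum_le_sum fun t _ => ?_
          apply mul_le_mul_of_nonneg_right _ (sq_nonneg _)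
          nlinarith [sq_nonneg (‖v s‖ - ‖v t‖)]
      _ = (∑ s, ‖v s‖ ^ 2 * ∑ t, K s t ^ 2) / 2 + (∑ t, ‖v t‖ ^ 2 * ∑ s, K t s ^ 2) / 2 := by
          have : ∀ s t, (‖v s‖ ^ 2 + ‖v t‖ ^ 2) / 2 * K s t ^ 2
              = ‖v s‖ ^ 2 * K s t ^ 2 / 2 + ‖v t‖ ^ 2 * K t s ^ 2 / 2 := by
            intro s t; rw [hK2 t s]; ring
          simp_rw [this, Finset.sum_add_distrib]
          congr 1
          · rw [Finset.sum_div]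
            refine Finset.sum_congr rfl fun s _ => ?_
            rw [Finset.mul_sum, Finset.sum_div]
          · rw [Finset.sum_comm, Finset.sum_div]
            refine Finset.sum_congr rfl fun t _ => ?_
            rw [Finset.mul_sum, Finset.sum_div]
      _ ≤ (∑ s, ‖v s‖ ^ 2 * S) / 2 + (∑ t, ‖v t‖ ^ 2 * S) / 2 := by
          gcongr with s _ t _
          · exact hS s
          · exact hS t
      _ = S * ∑ r, ‖v r‖ ^ 2 := by rw [← Finset.sum_mul]; ring
  -- diagonal bound
  have hDbd : ∑ s, ‖v s‖ ^ 2 * D s ≤ S * ∑ r, ‖v r‖ ^ 2 := by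
    rw [Finset.mul_sum]
    refine Finset.sum_le_sum fun s _ => ?_
    rw [mul_comm S]
    apply mul_le_mul_of_nonneg_left _ (sq_nonneg _)
    rw [hD]; simp only
    calc ∑ r, K r s ^ 2 = ∑ r, K s r ^ 2 := Finset.sum_congr rfl fun r _ => (hK2 s r)
      _ ≤ S := hS s
  -- assemble
  have hmain : ((μ ^ 2 * ∑ r, ‖v r‖ ^ 2 : ℝ) : ℂ) = ((∑ s, ‖v s‖ ^ 2 * D s : ℝ) : ℂ) + 0 - 2 * W := by
    rw [← hZ1, hZ2, hZ3]
  have hre := congrArg Complex.re hmain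
  simp only [Complex.ofReal_re, Complex.sub_re, Complex.add_re, Complex.zero_re,
    Complex.mul_re, Complex.re_ofNat, Complex.im_ofNat] at hre
  have hWre : |W.re| ≤ ‖W‖ := Complex.abs_re_le_norm W
  have := neg_abs_le W.re
  nlinarith


/-- `star w ⬝ᵥ w = ∑ ‖w i‖²` (as a complex number). [folklore] -/
theorem star_dotProduct_self_eq {n : Type*} [Fintype n] (w : n → ℂ) :
    star w ⬝ᵥ w = ((∑ i, ‖w i‖ ^ 2 : ℝ) : ℂ) := by
  rw [dotProduct]
  push_cast
  refine Finset.sum_congr rfl fun i _ => ?_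
  rw [Pi.star_apply, Complex.star_def, mul_comm, Complex.mul_conj, Complex.normSq_eq_norm_sq]
  push_cast; ring

/-- If every eigenvalue of a Hermitian matrix `A` is at most `Λ` in absolute value (tested on genuine
eigenvectors), then `|re (w* A w)| ≤ Λ ‖w‖²` for every `w` — the finite-dimensional spectral
theorem, via positive semidefiniteness of `Λ ± A`. [folklore] -/
theorem abs_re_quadForm_le {n : Type*} [Fintype n] [DecidableEq n]
    (A : Matrix n n ℂ) (hA : A.IsHermitian) (Λ : ℝ)
    (h : ∀ (μ : ℝ) (v : n → ℂ), v ≠ 0 → A *ᵥ v = (μ : ℂ) • v → |μ| ≤ Λ) (w : n → ℂ) :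
    |(star w ⬝ᵥ (A *ᵥ w)).re| ≤ Λ * ∑ i, ‖w i‖ ^ 2 := by
  have hΛsa : IsSelfAdjoint (Λ : ℂ) := by
    rw [IsSelfAdjoint, Complex.star_def, Complex.conj_ofReal]
  have h1 : ((Λ : ℂ) • (1 : Matrix n n ℂ)).IsHermitian := isHermitian_one.smul hΛsa
  -- both `Λ - A` and `Λ + A` are positive semidefinite
  have key : ∀ (ε : ℂ), (ε = 1 ∨ ε = -1) →
      ((Λ : ℂ) • (1 : Matrix n n ℂ) + ε • A).PosSemidef := by
    intro ε hε
    have hεsa : IsSelfAdjoint ε := by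
      rcases hε with rfl | rfl <;> simp [IsSelfAdjoint]
    have hB : ((Λ : ℂ) • (1 : Matrix n n ℂ) + ε • A).IsHermitian := h1.add (hA.smul hεsa)
    rw [hB.posSemidef_iff_eigenvalues_nonneg]
    intro i
    set u : n → ℂ := (hB.eigenvectorBasis i).ofLp with hu
    have hBu : ((Λ : ℂ) • (1 : Matrix n n ℂ) + ε • A) *ᵥ u = hB.eigenvalues i • u :=
      hB.mulVec_eigenvectorBasis i
    have hu0 : u ≠ 0 := by
      intro h0
      have hnorm : ‖hB.eigenvectorBasis i‖ = 1 := hB.eigenvectorBasis.orthonormal.1 i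
      have : hB.eigenvectorBasis i = 0 := (WithLp.ofLp_eq_zero 2).mp h0
      rw [this, norm_zero] at hnorm
      exact zero_ne_one hnorm
    -- `A u = ε (λ_i - Λ) u`
    have hAu : A *ᵥ u = ((ε * (hB.eigenvalues i - Λ) : ℂ).re : ℂ) • u := by
      have hre : ((ε * (hB.eigenvalues i - Λ) : ℂ).re : ℂ) = ε * (hB.eigenvalues i - Λ) := by
        rcases hε with rfl | rfl <;> simp
      rw [hre]
      rw [add_mulVec, smul_mulVec, one_mulVec, smul_mulVec] at hBu
      have hε2 : ε * ε = 1 := by rcases hε with rfl | rfl <;> norm_num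
      have : A *ᵥ u = ε • (ε • (A *ᵥ u)) := by rw [smul_smul, hε2, one_smul]
      rw [this, eq_sub_of_add_eq' hBu]
      ext j
      simp only [Pi.smul_apply, Pi.sub_apply, smul_eq_mul, Complex.real_smul]
      ring
    have hb := h _ u hu0 hAu
    have hΛ0 : 0 ≤ Λ := (abs_nonneg _).trans hb
    rcases hε with rfl | rfl
    · simp only [one_mul, Complex.sub_re, Complex.ofReal_re] at hb
      simp only [Pi.zero_apply]
      by_contra hneg
      rw [not_le] at hneg
      rw [abs_of_neg (by linarith)] at hb
      linarith
    · simp only [neg_mul, one_mul, Complex.neg_re, Complex.sub_re, Complex.ofReal_re] at hb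
      simp only [Pi.zero_apply]
      by_contra hneg
      rw [not_le] at hneg
      rw [abs_of_pos (by linarith)] at hb
      linarith
  have hplus := (key 1 (Or.inl rfl)).re_dotProduct_nonneg w
  have hminus := (key (-1) (Or.inr rfl)).re_dotProduct_nonneg w
  simp only [add_mulVec, smul_mulVec, one_mulVec, one_smul, neg_smul, neg_mulVec, dotProduct_add,
    dotProduct_neg, dotProduct_smul, star_dotProduct_self_eq, map_add, map_neg, smul_eq_mul,
    RCLike.re_to_complex, Complex.mul_re, Complex.ofReal_re, Complex.ofReal_im, mul_zero,
    sub_zero] at hplus hminus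
  rw [abs_le]
  constructor <;> linarith


/-! ### The periodic Hilbert inequality -/

section Hilbert

variable {ι : Type*} [Fintype ι] [DecidableEq ι]

/-- The cosecant kernel `K_{rs} = 1 / sin(π(x_r − x_s))` off the diagonal, `0` on it. (Off the
diagonal the value is also Lean's junk value `1/0 = 0` when `x_r − x_s ∈ ℤ`; that case is excluded by
every spacing hypothesis below, see `sin_ne_zero_of_sep`.) [cite: Montgomery1978, Cor 1, p. 556] -/
noncomputable def cosecK (x : ι → ℝ) (r s : ι) : ℝ :=
  if r = s then 0 else 1 / Real.sin (π * (x r - x s))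

/-- The cotangent kernel `cot(π(x_r − x_s))` (Mathlib's `Real.cot`) off the diagonal, `0` on it.
(As for `cosecK`, the off-diagonal value is the junk `cos/0 = 0` when `x_r − x_s ∈ ℤ`, a case
excluded by the spacing hypotheses.) [cite: Montgomery1978, §6, proof of Thm 2] -/
noncomputable def cotK (x : ι → ℝ) (r s : ι) : ℝ :=
  if r = s then 0 else Real.cot (π * (x r - x s))

omit [Fintype ι] [DecidableEq ι] in
/-- For `δ`-spaced points (`δ > 0`) and `r ≠ s`, `sin(π(x_r − x_s)) ≠ 0`. [folklore] -/
theorem sin_ne_zero_of_sep {x : ι → ℝ} {δ : ℝ} (hδ : 0 < δ)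
    (hsep : ∀ r s, r ≠ s → ∀ k : ℤ, δ ≤ |x r - x s - k|) {r s : ι} (hrs : r ≠ s) :
    Real.sin (π * (x r - x s)) ≠ 0 := by
  intro h0
  rw [Real.sin_eq_zero_iff] at h0
  obtain ⟨k, hk⟩ := h0
  have hk' : x r - x s = k := by
    have := mul_left_cancel₀ Real.pi_ne_zero (show π * (x r - x s) = π * k by rw [← hk]; ring)
    exact this
  have := hsep r s hrs k
  rw [hk', sub_self, abs_zero] at this
  linarith

omit [Fintype ι] in
/-- The cosecant kernel is antisymmetric: `K_{sr} = −K_{rs}`. [cite: Montgomery1978, §6, proof of Thm 2] -/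
theorem cosecK_anti (x : ι → ℝ) (r s : ι) : cosecK x s r = -cosecK x r s := by
  unfold cosecK
  by_cases h : r = s
  · subst h; simp
  · rw [if_neg (Ne.symm h), if_neg h, show π * (x s - x r) = -(π * (x r - x s)) by ring,
      Real.sin_neg]; ring

omit [Fintype ι] in
/-- The cotangent kernel is antisymmetric. [cite: Montgomery1978, §6, proof of Thm 2] -/
theorem cotK_anti (x : ι → ℝ) (r s : ι) : cotK x s r = -cotK x r s := by
  unfold cotK
  by_cases h : r = s
  · subst h; simp
  · rw [if_neg (Ne.symm h), if_neg h, Real.cot_eq_cos_div_sin, Real.cot_eq_cos_div_sin,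
      show π * (x s - x r) = -(π * (x r - x s)) by ring, Real.sin_neg, Real.cos_neg]; ring

omit [Fintype ι] in
/-- The trigonometric identity driving the Montgomery–Vaughan argument: for distinct `r, s, t`,
`cosec π(x_r−x_s) · cosec π(x_r−x_t) = cosec π(x_t−x_s) · (cot π(x_r−x_t) − cot π(x_r−x_s))`.
[cite: Montgomery1978, §6, proof of Thm 2 and Cor 1] -/
theorem cosecK_mul_cosecK {x : ι → ℝ} {δ : ℝ} (hδ : 0 < δ)
    (hsep : ∀ r s, r ≠ s → ∀ k : ℤ, δ ≤ |x r - x s - k|) {r s t : ι}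
    (hrs : r ≠ s) (hrt : r ≠ t) (hst : s ≠ t) :
    cosecK x r s * cosecK x r t = cosecK x t s * (cotK x r t - cotK x r s) := by
  have h1 := sin_ne_zero_of_sep hδ hsep hrs
  have h2 := sin_ne_zero_of_sep hδ hsep hrt
  have h3 := sin_ne_zero_of_sep hδ hsep (Ne.symm hst)
  unfold cosecK cotK
  simp only [if_neg hrs, if_neg hrt, if_neg (Ne.symm hst), Real.cot_eq_cos_div_sin]
  have hab : π * (x t - x s) = π * (x r - x s) - π * (x r - x t) := by ring
  rw [hab, Real.sin_sub] at h3 ⊢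
  set Sa := Real.sin (π * (x r - x s))
  set Sb := Real.sin (π * (x r - x t))
  set Ca := Real.cos (π * (x r - x s))
  set Cb := Real.cos (π * (x r - x t))
  rw [div_sub_div _ _ h2 h1, show Cb * Sa - Sb * Ca = Sa * Cb - Ca * Sb by ring,
    one_div_mul_one_div, div_mul_div_comm, one_mul]
  conv_rhs => rw [div_mul_eq_div_div, div_self h3, mul_comm Sb Sa]

omit [Fintype ι] in
/-- `|cosec π(x_t−x_s) · cot π(x_s−x_t)| ≤ cosec² π(x_s−x_t)` (as `|cos| ≤ 1`). [folklore] -/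
theorem abs_cosecK_mul_cotK_le (x : ι → ℝ) (s t : ι) :
    |cosecK x t s * cotK x s t| ≤ cosecK x s t ^ 2 := by
  unfold cosecK cotK
  by_cases h : s = t
  · subst h; simp
  · simp only [if_neg (Ne.symm h), if_neg h, Real.cot_eq_cos_div_sin]
    rw [show π * (x t - x s) = -(π * (x s - x t)) by ring, Real.sin_neg]
    set S := Real.sin (π * (x s - x t))
    set C := Real.cos (π * (x s - x t))
    by_cases hS : S = 0
    · simp [hS]
    · rw [show 1 / -S * (C / S) = -(C / S ^ 2) by field_simp, abs_neg, abs_div,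
        abs_of_nonneg (sq_nonneg S), div_pow, one_pow]
      exact div_le_div_of_nonneg_right (Real.abs_cos_le_one _) (sq_nonneg S)

/-- Row sums of the squared cosecant kernel at `δ`-spaced points:
`∑_{t ≠ s} 1/sin²(π(x_s − x_t)) ≤ δ⁻²/3 + δ⁻¹`. [cite: Montgomery1978, §6, proof of Cor 1, p. 556] -/
theorem sum_cosecK_sq_le {x : ι → ℝ} {δ : ℝ} (hδ : 0 < δ)
    (hsep : ∀ r s, r ≠ s → ∀ k : ℤ, δ ≤ |x r - x s - k|) (s : ι) :
    ∑ t, cosecK x s t ^ 2 ≤ δ⁻¹ ^ 2 / 3 + δ⁻¹ := by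
  set f : ι → ℝ := fun t => x t - x s - round (x t - x s) with hf
  have hfabs : ∀ t, |f t| ≤ 1 / 2 := fun t => abs_sub_round _
  have hflow : ∀ t, t ≠ s → δ ≤ |f t| := fun t ht => hsep t s ht _
  have hfsep : ∀ t t', t ≠ t' → δ ≤ |f t - f t'| := by
    intro t t' htt'
    have := hsep t t' htt' (round (x t - x s) - round (x t' - x s))
    convert this using 2
    simp only [hf]; push_cast; ring
  have hinj : Set.InjOn f ↑(univ.erase s) := by
    intro t _ t' _ hft
    by_contra htt'
    have := hfsep t t' htt'
    rw [hft, sub_self, abs_zero] at this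
    linarith
  set E := (univ.erase s).image f with hE
  have hE1 : ∀ e ∈ E, δ ≤ |e| := by
    intro e he; rw [hE, mem_image] at he
    obtain ⟨t, ht, rfl⟩ := he
    exact hflow t (ne_of_mem_erase ht)
  have hE2 : ∀ e ∈ E, ∀ e' ∈ E, e ≠ e' → δ ≤ |e - e'| := by
    intro e he e' he' hne
    rw [hE, mem_image] at he he'
    obtain ⟨t, _, rfl⟩ := he
    obtain ⟨t', _, rfl⟩ := he'
    exact hfsep t t' (fun h => hne (by rw [h]))
  have hE3 : ∀ e ∈ E, |e| ≤ 1 / 2 := by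
    intro e he; rw [hE, mem_image] at he
    obtain ⟨t, _, rfl⟩ := he
    exact hfabs t
  obtain ⟨hEsum, hEcard⟩ := spacing_sum_le δ hδ E hE1 hE2 hE3
  -- rewrite the kernel in terms of `f`
  have hsin2 : ∀ t, Real.sin (π * (x s - x t)) ^ 2 = Real.sin (π * f t) ^ 2 := by
    intro t
    rw [Real.sin_sq_eq_half_sub, Real.sin_sq_eq_half_sub]
    congr 2
    have : 2 * (π * (x s - x t)) = -(2 * (π * f t) + (round (x t - x s) : ℤ) * (2 * π)) := by
      simp only [hf]; ring
    rw [this, Real.cos_neg, Real.cos_add_int_mul_two_pi]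
  have hterm : ∀ t ∈ univ.erase s, cosecK x s t ^ 2 ≤ π⁻¹ ^ 2 * (1 / f t ^ 2) + 1 := by
    intro t ht
    have hts : t ≠ s := ne_of_mem_erase ht
    unfold cosecK
    rw [if_neg (Ne.symm hts), div_pow, one_pow, hsin2 t]
    have hft0 : f t ≠ 0 := by
      intro h0; have := hflow t hts; rw [h0, abs_zero] at this; linarith
    have hu : π * f t ≠ 0 := mul_ne_zero Real.pi_ne_zero hft0
    have hu' : |π * f t| ≤ π / 2 := by
      rw [abs_mul, abs_of_pos Real.pi_pos]
      have := hfabs t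
      calc π * |f t| ≤ π * (1 / 2) := by gcongr
        _ = π / 2 := by ring
    calc 1 / Real.sin (π * f t) ^ 2 ≤ 1 / (π * f t) ^ 2 + 1 := one_div_sin_sq_le hu hu'
      _ = π⁻¹ ^ 2 * (1 / f t ^ 2) + 1 := by
          rw [mul_pow]; field_simp
  calc ∑ t, cosecK x s t ^ 2 = ∑ t ∈ univ.erase s, cosecK x s t ^ 2 := by
        rw [← Finset.sum_erase_add _ _ (mem_univ s)]
        simp [cosecK]
    _ ≤ ∑ t ∈ univ.erase s, (π⁻¹ ^ 2 * (1 / f t ^ 2) + 1) := Finset.sum_le_sum hterm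
    _ = π⁻¹ ^ 2 * ∑ e ∈ E, 1 / e ^ 2 + E.card := by
        rw [Finset.sum_add_distrib, ← Finset.mul_sum, hE, Finset.sum_image hinj,
          Finset.card_image_of_injOn hinj]
        simp
    _ ≤ π⁻¹ ^ 2 * (π ^ 2 / 3 * δ⁻¹ ^ 2) + δ⁻¹ := by gcongr
    _ = δ⁻¹ ^ 2 / 3 + δ⁻¹ := by field_simp


/-- **Montgomery–Vaughan's periodic Hilbert inequality** (crude constant): if the `x_r` are `δ`-spaced
modulo `1`, then `|∑_{r ≠ s} w_r w̄_s / sin(π(x_r − x_s))| ≤ (δ⁻¹ + 3/2) ∑_r |w_r|²`. Montgomery–Vaughan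
prove this with `δ⁻¹` in place of `δ⁻¹ + 3/2`; the cruder constant, which comes from the elementary
bounds in `sum_cosecK_sq_le`, is absorbed by Cohen's dilation below.
[cite: Montgomery1978, Thm 2 (p. 554) and Cor 1 (p. 556)] -/
theorem hilbert_inequality {x : ι → ℝ} {δ : ℝ} (hδ : 0 < δ)
    (hsep : ∀ r s, r ≠ s → ∀ k : ℤ, δ ≤ |x r - x s - k|) (w : ι → ℂ) :
    ‖∑ r, ∑ s, w r * conj (w s) * (cosecK x r s : ℂ)‖ ≤ (δ⁻¹ + 3 / 2) * ∑ r, ‖w r‖ ^ 2 := by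
  set S : ℝ := δ⁻¹ ^ 2 / 3 + δ⁻¹ with hSdef
  have hS : ∀ s, ∑ t, cosecK x s t ^ 2 ≤ S := sum_cosecK_sq_le hδ hsep
  set Λ : ℝ := δ⁻¹ + 3 / 2 with hΛdef
  have hδi : 0 < δ⁻¹ := inv_pos.mpr hδ
  have hΛ0 : 0 ≤ Λ := by positivity
  have h3S : 3 * S ≤ Λ ^ 2 := by rw [hSdef, hΛdef]; nlinarith
  -- the Hermitian matrix `i K`
  set A : Matrix ι ι ℂ := fun r s => I * (cosecK x r s : ℂ) with hAdef
  have hA : A.IsHermitian := by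
    refine Matrix.IsHermitian.ext fun r s => ?_
    simp only [hAdef, Complex.star_def, map_mul, Complex.conj_I, Complex.conj_ofReal]
    rw [cosecK_anti x r s]; push_cast; ring
  -- eigenvalue bound via the Montgomery–Vaughan computation
  have heig : ∀ (μ : ℝ) (v : ι → ℂ), v ≠ 0 → A *ᵥ v = (μ : ℂ) • v → |μ| ≤ Λ := by
    intro μ v hv0 hAv
    have hv : ∀ r, ∑ s, (cosecK x r s : ℂ) * v s = I * (-μ : ℝ) * v r := by
      intro r
      have hr := congrFun hAv r
      simp only [Matrix.mulVec, dotProduct, hAdef, Pi.smul_apply, smul_eq_mul] at hr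
      have hr' : I * ∑ s, (cosecK x r s : ℂ) * v s = μ * v r := by
        rw [← hr, Finset.mul_sum]; refine Finset.sum_congr rfl fun s _ => ?_; ring
      have h2 : -I * (I * ∑ s, (cosecK x r s : ℂ) * v s) = -I * (μ * v r) := by rw [hr']
      rw [← mul_assoc, show -I * I = 1 by rw [neg_mul, Complex.I_mul_I, neg_neg], one_mul] at h2
      rw [h2]; push_cast; ring
    have hmv := mv_core (cosecK x) (cotK x) (cosecK_anti x) (cotK_anti x)
      (fun r s t hrs hrt hst => cosecK_mul_cosecK hδ hsep hrs hrt hst)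
      (abs_cosecK_mul_cotK_le x) S hS (-μ) v hv
    have hpos : 0 < ∑ r, ‖v r‖ ^ 2 := by
      obtain ⟨r, hr⟩ : ∃ r, v r ≠ 0 := by
        by_contra hall
        push Not at hall
        exact hv0 (funext hall)
      exact lt_of_lt_of_le (by positivity) (Finset.single_le_sum (fun r _ => sq_nonneg ‖v r‖) (mem_univ r))
    have hμ2 : μ ^ 2 ≤ Λ ^ 2 := by
      have := le_of_mul_le_mul_right hmv hpos
      rw [neg_sq] at this
      linarith
    exact abs_le_of_sq_le_sq' hμ2 hΛ0 |> fun h => abs_le.mpr h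
  have hquad := abs_re_quadForm_le A hA Λ heig w
  -- relate the bilinear form to the quadratic form of `A`
  set B : ℂ := ∑ r, ∑ s, w r * conj (w s) * (cosecK x r s : ℂ) with hBdef
  set Q : ℂ := star w ⬝ᵥ (A *ᵥ w) with hQdef
  have hQB : Q = I * conj B := by
    rw [hQdef, hBdef, dotProduct, map_sum, Finset.mul_sum]
    refine Finset.sum_congr rfl fun r _ => ?_
    rw [map_sum, Matrix.mulVec, dotProduct, Finset.mul_sum, Finset.mul_sum]
    refine Finset.sum_congr rfl fun s _ => ?_
    simp only [hAdef, Pi.star_apply, Complex.star_def, map_mul, Complex.conj_conj,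
      Complex.conj_ofReal]
    ring
  have hBanti : conj B = -B := by
    rw [hBdef, map_sum]
    simp only [map_sum, map_mul, Complex.conj_conj, Complex.conj_ofReal]
    rw [Finset.sum_comm, ← Finset.sum_neg_distrib]
    refine Finset.sum_congr rfl fun r _ => ?_
    rw [← Finset.sum_neg_distrib]
    refine Finset.sum_congr rfl fun s _ => ?_
    rw [cosecK_anti x s r]; push_cast; ring
  have hBQ : B = I * Q := by
    rw [hQB, hBanti, ← mul_assoc, Complex.I_mul_I]; ring
  have hQim : Q.im = 0 := by
    have : conj Q = Q := by
      rw [hQB, map_mul, Complex.conj_I, Complex.conj_conj, hBanti]; ring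
    exact Complex.conj_eq_iff_im.mp this
  have hnorm : ‖B‖ = |Q.re| := by
    rw [hBQ, norm_mul, Complex.norm_I, one_mul]
    conv_lhs => rw [show Q = (Q.re : ℂ) from Complex.ext (by simp) (by simp [hQim])]
    rw [Complex.norm_real, Real.norm_eq_abs]
  rw [hnorm]
  exact hquad


/-! ### The dual large sieve -/

omit [Fintype ι] in
/-- The inner sums of the dual form: `∑_{M<n≤M+N} e(n x_r) conj e(n x_s)` equals `N` if `r = s` and
otherwise the closed-form geometric sum, written with the cosecant kernel.
[cite: Montgomery1978, §4, p. 551, the derivation of (6)] -/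
theorem sum_e_mul_conj_e {x : ι → ℝ} {δ : ℝ} (hδ : 0 < δ)
    (hsep : ∀ r s, r ≠ s → ∀ k : ℤ, δ ≤ |x r - x s - k|) (M : ℤ) (N : ℕ) (r s : ι) :
    ∑ n ∈ Ioc M (M + N), e (n * x r) * conj (e (n * x s)) =
      (if r = s then (N : ℂ) else 0) +
        (e (((M : ℝ) + N + 1 / 2) * x r) * conj (e (((M : ℝ) + N + 1 / 2) * x s))
          - e (((M : ℝ) + 1 / 2) * x r) * conj (e (((M : ℝ) + 1 / 2) * x s)))
          * (cosecK x r s : ℂ) / (2 * I) := by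
  by_cases hrs : r = s
  · subst hrs
    simp only [e_mul_conj, Finset.sum_const, nsmul_eq_mul, mul_one, if_true, cosecK,
      Complex.ofReal_zero, mul_zero, zero_div, add_zero, Int.card_Ioc]
    congr 1
    omega
  · rw [if_neg hrs, zero_add]
    have hsin := sin_ne_zero_of_sep hδ hsep hrs
    have hgeom := geom_sum_e M N (x r - x s)
    have hI : (2 : ℂ) * I ≠ 0 := mul_ne_zero two_ne_zero Complex.I_ne_zero
    have hsinC : (Real.sin (π * (x r - x s)) : ℂ) ≠ 0 := by exact_mod_cast hsin
    simp only [← e_sub]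
    unfold cosecK
    rw [if_neg hrs]
    rw [eq_div_iff hI]
    have : ∑ n ∈ Ioc M (M + N), e (n * x r - n * x s) = ∑ n ∈ Ioc M (M + N), e (n * (x r - x s)) := by
      refine Finset.sum_congr rfl fun n _ => ?_; ring_nf
    rw [this]
    have h2 : ∑ n ∈ Ioc M (M + ↑N), e (↑n * (x r - x s)) =
        (e ((↑M + ↑N + 1 / 2) * (x r - x s)) - e ((↑M + 1 / 2) * (x r - x s))) /
          (2 * I * ↑(Real.sin (π * (x r - x s)))) := by
      rw [eq_div_iff (mul_ne_zero hI hsinC), mul_comm, hgeom]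
    rw [h2]
    push_cast
    field_simp

/-- **Dual large sieve** (crude constant): for `δ`-spaced `x_r`,
`∑_{M<n≤M+N} |∑_r c_r e(n x_r)|² ≤ (N + δ⁻¹ + 3/2) ∑_r |c_r|²`.
[cite: Montgomery1978, §4, (6) p. 551, with Cor 1 and Cor 2, p. 556; MontgomeryVaughanMathematika1973, Thm 1] -/
theorem largeSieve_dual {x : ι → ℝ} {δ : ℝ} (hδ : 0 < δ)
    (hsep : ∀ r s, r ≠ s → ∀ k : ℤ, δ ≤ |x r - x s - k|) (c : ι → ℂ) (M : ℤ) (N : ℕ) :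
    ∑ n ∈ Ioc M (M + N), ‖∑ r, c r * e (n * x r)‖ ^ 2 ≤
      ((N : ℝ) + (δ⁻¹ + 3 / 2)) * ∑ r, ‖c r‖ ^ 2 := by
  set a : ℝ := (M : ℝ) + N + 1 / 2 with ha
  set b : ℝ := (M : ℝ) + 1 / 2 with hb
  set u : ι → ℂ := fun r => c r * e (a * x r) with hu
  set u' : ι → ℂ := fun r => c r * e (b * x r) with hu'
  set B : (ι → ℂ) → ℂ := fun w => ∑ r, ∑ s, w r * conj (w s) * (cosecK x r s : ℂ) with hB
  have hnu : ∀ r, ‖u r‖ = ‖c r‖ := fun r => by simp [hu]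
  have hnu' : ∀ r, ‖u' r‖ = ‖c r‖ := fun r => by simp [hu']
  -- the complex form of the left-hand side
  have hZ : ((∑ n ∈ Ioc M (M + N), ‖∑ r, c r * e (n * x r)‖ ^ 2 : ℝ) : ℂ) =
      (N : ℂ) * ((∑ r, ‖c r‖ ^ 2 : ℝ) : ℂ) + (B u - B u') / (2 * I) := by
    calc ((∑ n ∈ Ioc M (M + N), ‖∑ r, c r * e (n * x r)‖ ^ 2 : ℝ) : ℂ)
        = ∑ n ∈ Ioc M (M + N), (∑ r, c r * e (n * x r)) * conj (∑ s, c s * e (n * x s)) := by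
          push_cast
          refine Finset.sum_congr rfl fun n _ => ?_
          rw [Complex.mul_conj, Complex.normSq_eq_norm_sq]; push_cast; ring
      _ = ∑ n ∈ Ioc M (M + N), ∑ r, ∑ s,
            c r * conj (c s) * (e (n * x r) * conj (e (n * x s))) := by
          refine Finset.sum_congr rfl fun n _ => ?_
          rw [map_sum, Finset.sum_mul_sum]
          refine Finset.sum_congr rfl fun r _ => Finset.sum_congr rfl fun s _ => ?_
          rw [map_mul]; ring
      _ = ∑ r, ∑ s, c r * conj (c s) *
            ∑ n ∈ Ioc M (M + N), e (n * x r) * conj (e (n * x s)) := by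
          rw [Finset.sum_comm]
          refine Finset.sum_congr rfl fun r _ => ?_
          rw [Finset.sum_comm]
          refine Finset.sum_congr rfl fun s _ => ?_
          rw [Finset.mul_sum]
      _ = ∑ r, ∑ s, c r * conj (c s) * ((if r = s then (N : ℂ) else 0) +
            (e (a * x r) * conj (e (a * x s)) - e (b * x r) * conj (e (b * x s)))
              * (cosecK x r s : ℂ) / (2 * I)) := by
          refine Finset.sum_congr rfl fun r _ => Finset.sum_congr rfl fun s _ => ?_
          rw [sum_e_mul_conj_e hδ hsep M N r s]
      _ = (N : ℂ) * ((∑ r, ‖c r‖ ^ 2 : ℝ) : ℂ) + (B u - B u') / (2 * I) := by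
          simp only [mul_add, Finset.sum_add_distrib]
          congr 1
          · push_cast
            rw [Finset.mul_sum]
            refine Finset.sum_congr rfl fun r _ => ?_
            rw [Fintype.sum_eq_single r (fun s hs => by rw [if_neg (Ne.symm hs)]; simp)]
            rw [if_pos rfl, Complex.mul_conj, Complex.normSq_eq_norm_sq]; push_cast; ring
          · rw [hB]; simp only
            rw [← Finset.sum_sub_distrib, Finset.sum_div]
            refine Finset.sum_congr rfl fun r _ => ?_
            rw [← Finset.sum_sub_distrib, Finset.sum_div]
            refine Finset.sum_congr rfl fun s _ => ?_
            simp only [hu, hu', map_mul]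
            ring
  -- Hilbert's inequality for `u` and `u'`
  have hBu := hilbert_inequality hδ hsep u
  have hBu' := hilbert_inequality hδ hsep u'
  simp only [hnu, hnu'] at hBu hBu'
  -- take real parts
  have hre := congrArg Complex.re hZ
  rw [Complex.ofReal_re] at hre
  rw [hre]
  simp only [Complex.add_re, Complex.mul_re, Complex.natCast_re, Complex.natCast_im,
    Complex.ofReal_re, Complex.ofReal_im, mul_zero, sub_zero]
  have hdiv : ((B u - B u') / (2 * I)).re ≤ (‖B u‖ + ‖B u'‖) / 2 := by
    calc ((B u - B u') / (2 * I)).re ≤ ‖(B u - B u') / (2 * I)‖ := Complex.re_le_norm _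
      _ = ‖B u - B u'‖ / 2 := by rw [norm_div, norm_mul, Complex.norm_I, Complex.norm_two, mul_one]
      _ ≤ (‖B u‖ + ‖B u'‖) / 2 := by gcongr; exact norm_sub_le _ _
  nlinarith [hBu, hBu', hdiv, Finset.sum_nonneg (fun r (_ : r ∈ univ) => sq_nonneg ‖c r‖)]


omit [DecidableEq ι] in
/-- **Duality principle** (case `p₁ = p₂ = 2`): if `D ≥ 0` and `∑_{n ∈ F} |∑_r c_r φ_n(r)|² ≤ D ∑_r |c_r|²`
for all `c`, then `∑_r |∑_{n ∈ F} a_n φ_n(r)|² ≤ D ∑_{n ∈ F} |a_n|²` for all `a`.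
[cite: Montgomery1978, §4, Lemma 2, p. 550] -/
theorem duality {κ : Type*} (F : Finset κ) (φ : κ → ι → ℂ) (D : ℝ) (hD : 0 ≤ D)
    (h : ∀ c : ι → ℂ, ∑ n ∈ F, ‖∑ r, c r * φ n r‖ ^ 2 ≤ D * ∑ r, ‖c r‖ ^ 2)
    (a : κ → ℂ) :
    ∑ r, ‖∑ n ∈ F, a n * φ n r‖ ^ 2 ≤ D * ∑ n ∈ F, ‖a n‖ ^ 2 := by
  set S : ι → ℂ := fun r => ∑ n ∈ F, a n * φ n r with hS
  set Sig : ℝ := ∑ r, ‖S r‖ ^ 2 with hSig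
  set A : ℝ := ∑ n ∈ F, ‖a n‖ ^ 2 with hA
  set c : ι → ℂ := fun r => conj (S r) with hc
  set T : κ → ℂ := fun n => ∑ r, c r * φ n r with hT
  have hA0 : 0 ≤ A := Finset.sum_nonneg fun n _ => sq_nonneg _
  have hSig0 : 0 ≤ Sig := Finset.sum_nonneg fun r _ => sq_nonneg _
  -- `Σ = ∑ a_n T_n`
  have hSigT : (Sig : ℂ) = ∑ n ∈ F, a n * T n := by
    rw [hSig]; push_cast
    calc ∑ r, ((‖S r‖ : ℂ)) ^ 2 = ∑ r, conj (S r) * ∑ n ∈ F, a n * φ n r := by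
          refine Finset.sum_congr rfl fun r _ => ?_
          have : ((‖S r‖ : ℂ)) ^ 2 = ((‖S r‖ ^ 2 : ℝ) : ℂ) := by push_cast; ring
          rw [this, ← Complex.normSq_eq_norm_sq, ← Complex.mul_conj, mul_comm]
      _ = ∑ r, ∑ n ∈ F, conj (S r) * (a n * φ n r) := by
          refine Finset.sum_congr rfl fun r _ => Finset.mul_sum _ _ _
      _ = ∑ n ∈ F, ∑ r, conj (S r) * (a n * φ n r) := Finset.sum_comm
      _ = ∑ n ∈ F, a n * T n := by
          refine Finset.sum_congr rfl fun n _ => ?_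
          rw [hT, hc]; simp only; rw [Finset.mul_sum]
          refine Finset.sum_congr rfl fun r _ => ?_; ring
  have hcS : ∀ r, ‖c r‖ = ‖S r‖ := fun r => by simp [hc]
  have hTbd : ∑ n ∈ F, ‖T n‖ ^ 2 ≤ D * Sig := by
    have := h c
    simp only [hcS] at this
    exact this
  -- Cauchy–Schwarz
  have hCS : Sig ^ 2 ≤ A * (D * Sig) := by
    calc Sig ^ 2 = ‖(Sig : ℂ)‖ ^ 2 := by rw [Complex.norm_real, Real.norm_eq_abs, abs_of_nonneg hSig0]
      _ ≤ (∑ n ∈ F, ‖a n‖ * ‖T n‖) ^ 2 := by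
          rw [hSigT]
          gcongr
          exact (norm_sum_le _ _).trans (le_of_eq (Finset.sum_congr rfl fun n _ => norm_mul _ _))
      _ ≤ (∑ n ∈ F, ‖a n‖ ^ 2) * ∑ n ∈ F, ‖T n‖ ^ 2 := Finset.sum_mul_sq_le_sq_mul_sq _ _ _
      _ ≤ A * (D * Sig) := by rw [hA]; gcongr
  by_cases hSigpos : Sig = 0
  · rw [hSigpos]; positivity
  · have hpos : 0 < Sig := lt_of_le_of_ne hSig0 (Ne.symm hSigpos)
    have : Sig * Sig ≤ (D * A) * Sig := by nlinarith
    exact le_of_mul_le_mul_right this hpos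

/-- **Large sieve, crude constant**: for `δ`-spaced `x_r` and frequencies in a finite set
`F ⊆ (M, M + N]`, `∑_r |∑_{n ∈ F} a_n e(n x_r)|² ≤ (N + δ⁻¹ + 3/2) ∑_{n ∈ F} |a_n|²`.
[cite: Montgomery1978, Cor 2, p. 556; MontgomeryVaughanMathematika1973, Thm 1 (there with `N + δ⁻¹`)] -/
theorem largeSieve_weak {x : ι → ℝ} {δ : ℝ} (hδ : 0 < δ)
    (hsep : ∀ r s, r ≠ s → ∀ k : ℤ, δ ≤ |x r - x s - k|) (M : ℤ) (N : ℕ)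
    (F : Finset ℤ) (hF : F ⊆ Ioc M (M + N)) (a : ℤ → ℂ) :
    ∑ r, ‖∑ n ∈ F, a n * e (n * x r)‖ ^ 2 ≤
      ((N : ℝ) + (δ⁻¹ + 3 / 2)) * ∑ n ∈ F, ‖a n‖ ^ 2 := by
  have hδi : 0 < δ⁻¹ := inv_pos.mpr hδ
  refine duality F (fun n r => e (n * x r)) _ (by positivity) (fun c => ?_) a
  calc ∑ n ∈ F, ‖∑ r, c r * e (n * x r)‖ ^ 2
      ≤ ∑ n ∈ Ioc M (M + N), ‖∑ r, c r * e (n * x r)‖ ^ 2 :=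
        Finset.sum_le_sum_of_subset_of_nonneg hF fun n _ _ => sq_nonneg _
    _ ≤ ((N : ℝ) + (δ⁻¹ + 3 / 2)) * ∑ r, ‖c r‖ ^ 2 := largeSieve_dual hδ hsep c M N


/-! ### Cohen's dilation trick: the sharp constant `N - 1 + δ⁻¹` -/

omit [Fintype ι] [DecidableEq ι] in
/-- Cohen's dilation: if the `x_r` are `δ`-spaced modulo `1` (`δ ≤ 1`), the points `(x_r + k)/K`,
`0 ≤ k < K`, are `δ/K`-spaced modulo `1`. [cite: Montgomery1978, p. 559, note added in proof] -/
theorem sep_dilate {x : ι → ℝ} {δ : ℝ} (hδ1 : δ ≤ 1)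
    (hsep : ∀ r s, r ≠ s → ∀ k : ℤ, δ ≤ |x r - x s - k|) (K : ℕ) (hK : 0 < K) :
    ∀ p q : ι × Fin K, p ≠ q → ∀ m : ℤ,
      δ / K ≤ |(x p.1 + ((p.2 : ℕ) : ℝ)) / K - (x q.1 + ((q.2 : ℕ) : ℝ)) / K - m| := by
  intro p q hpq m
  have hKr : (0 : ℝ) < K := by exact_mod_cast hK
  have hrew : (x p.1 + ((p.2 : ℕ) : ℝ)) / K - (x q.1 + ((q.2 : ℕ) : ℝ)) / K - m =
      (x p.1 - x q.1 - ((m * K - (p.2 : ℕ) + (q.2 : ℕ) : ℤ) : ℝ)) / K := by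
    push_cast; field_simp; ring
  rw [hrew, abs_div, abs_of_pos hKr, div_le_div_iff_of_pos_right hKr]
  by_cases hrs : p.1 = q.1
  · have hk : p.2 ≠ q.2 := fun h => hpq (Prod.ext hrs h)
    rw [hrs, sub_self, zero_sub, abs_neg]
    have hne : (m * K - (p.2 : ℕ) + (q.2 : ℕ) : ℤ) ≠ 0 := by
      intro h0
      have hp2 := p.2.isLt
      have hq2 := q.2.isLt
      have hK0 : (0 : ℤ) < K := by exact_mod_cast hK
      have hmK : m * (K : ℤ) = (p.2 : ℕ) - (q.2 : ℕ) := by linarith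
      rcases lt_trichotomy m 0 with hm | hm | hm
      · have : m * (K : ℤ) ≤ -1 * K := mul_le_mul_of_nonneg_right (by omega) hK0.le
        omega
      · subst hm
        simp only [zero_mul] at hmK
        apply hk
        apply Fin.ext
        omega
      · have : 1 * (K : ℤ) ≤ m * K := mul_le_mul_of_nonneg_right (by omega) hK0.le
        omega
    have h1 : (1 : ℝ) ≤ |((m * K - (p.2 : ℕ) + (q.2 : ℕ) : ℤ) : ℝ)| := by
      exact_mod_cast Int.one_le_abs hne
    linarith
  · exact hsep p.1 q.1 hrs _

/-- Generic real-inequality helper (not a cited result): if `A ≤ B + C/K` for every positive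
integer `K` (with `C ≥ 0`), then `A ≤ B`. [folklore] -/
theorem le_of_forall_le_add_div {A B C : ℝ} (hC : 0 ≤ C)
    (h : ∀ K : ℕ, 0 < K → A ≤ B + C / K) : A ≤ B := by
  refine le_of_forall_pos_le_add fun ε hε => ?_
  obtain ⟨K, hK⟩ := exists_nat_gt (C / ε)
  have hKpos : (0 : ℝ) < K := lt_of_le_of_lt (by positivity) hK
  have hK' : 0 < K := by exact_mod_cast hKpos
  have := h K hK'
  have hCK : C / K ≤ ε := by
    rw [div_le_iff₀ hKpos]
    rw [div_lt_iff₀ hε] at hK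
    linarith
  linarith

/-- **The large sieve inequality with Selberg's constant.** If the points `x_r` (`r` in a finite
type) are `δ`-spaced modulo `1`, `0 < δ ≤ 1`, then for complex `a_n` and `N ≥ 1`,
`∑_r |∑_{M<n≤M+N} a_n e(n x_r)|² ≤ (N − 1 + δ⁻¹) ∑_{M<n≤M+N} |a_n|²`.
Proof: Montgomery–Vaughan's inequality (`largeSieve_weak`) sharpened by Paul Cohen's dilation
trick. [cite: Montgomery1978, Thm 3 (Selberg), p. 559, and the note added in proof, p. 559] -/
theorem largeSieve_sharp {x : ι → ℝ} {δ : ℝ} (hδ : 0 < δ) (hδ1 : δ ≤ 1)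
    (hsep : ∀ r s, r ≠ s → ∀ k : ℤ, δ ≤ |x r - x s - k|) (a : ℤ → ℂ) (M : ℤ) (N : ℕ)
    (hN : 1 ≤ N) :
    ∑ r, ‖∑ n ∈ Ioc M (M + N), a n * e (n * x r)‖ ^ 2 ≤
      ((N : ℝ) - 1 + δ⁻¹) * ∑ n ∈ Ioc M (M + N), ‖a n‖ ^ 2 := by
  obtain ⟨N₀, rfl⟩ : ∃ N₀, N = N₀ + 1 := ⟨N - 1, by omega⟩
  set Sig := ∑ r, ‖∑ n ∈ Ioc M (M + ↑(N₀ + 1)), a n * e (n * x r)‖ ^ 2 with hSig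
  set A := ∑ n ∈ Ioc M (M + ↑(N₀ + 1)), ‖a n‖ ^ 2 with hA
  have hA0 : 0 ≤ A := Finset.sum_nonneg fun n _ => sq_nonneg _
  have hδi : 0 < δ⁻¹ := inv_pos.mpr hδ
  have hmain : ∀ K : ℕ, 0 < K →
      (K : ℝ) * Sig ≤ ((K : ℝ) * N₀ + 1 + ((K : ℝ) * δ⁻¹ + 3 / 2)) * A := by
    intro K hK
    have hKr : (0 : ℝ) < K := by exact_mod_cast hK
    have hK0 : (K : ℤ) ≠ 0 := by exact_mod_cast hK.ne'
    -- the dilated system of points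
    set y : ι × Fin K → ℝ := fun p => (x p.1 + ((p.2 : ℕ) : ℝ)) / K with hy
    have hsep' : ∀ p q, p ≠ q → ∀ m : ℤ, δ / K ≤ |y p - y q - m| :=
      sep_dilate hδ1 hsep K hK
    -- the dilated frequencies
    set F' : Finset ℤ := (Ioc M (M + ↑(N₀ + 1))).image (fun n => n * K) with hF'def
    set M' : ℤ := K * (M + 1) - 1 with hM'
    have hF' : F' ⊆ Ioc M' (M' + ↑(K * N₀ + 1)) := by
      intro m hm
      rw [hF'def, Finset.mem_image] at hm
      obtain ⟨n, hn, rfl⟩ := hm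
      rw [Finset.mem_Ioc] at hn ⊢
      have hKz : (0 : ℤ) ≤ K := by exact_mod_cast hK.le
      obtain ⟨hn1, hn2⟩ := hn
      constructor
      · have : (M + 1) * (K : ℤ) ≤ n * K := mul_le_mul_of_nonneg_right (by omega) hKz
        rw [hM']; linarith
      · have : n * (K : ℤ) ≤ (M + N₀ + 1) * K :=
          mul_le_mul_of_nonneg_right (by push_cast at hn2; omega) hKz
        rw [hM']; push_cast; linarith
    set b : ℤ → ℂ := fun m => a (m / K) with hb
    have hweak := largeSieve_weak (ι := ι × Fin K) (div_pos hδ hKr) hsep' M' (K * N₀ + 1) F' hF' b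
    have hinj : Set.InjOn (fun n : ℤ => n * K) ↑(Ioc M (M + ↑(N₀ + 1))) :=
      (mul_left_injective₀ hK0).injOn
    have hLHS : ∀ p : ι × Fin K, ∑ m ∈ F', b m * e (m * y p) =
        ∑ n ∈ Ioc M (M + ↑(N₀ + 1)), a n * e (n * x p.1) := by
      intro p
      rw [hF'def, Finset.sum_image hinj]
      refine Finset.sum_congr rfl fun n _ => ?_
      simp only [hb, hy, Int.mul_ediv_cancel _ hK0]
      congr 1
      apply e_eq_of_sub_eq_int (n * (p.2 : ℕ))
      push_cast; field_simp; ring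
    have hRHS : ∑ m ∈ F', ‖b m‖ ^ 2 = A := by
      rw [hF'def, Finset.sum_image hinj]
      simp only [hb, Int.mul_ediv_cancel _ hK0, hA]
    rw [hRHS] at hweak
    simp only [hLHS] at hweak
    rw [Fintype.sum_prod_type] at hweak
    simp only [Finset.sum_const, Finset.card_univ, Fintype.card_fin, nsmul_eq_mul] at hweak
    rw [← Finset.mul_sum] at hweak
    have hcast : ((K * N₀ + 1 : ℕ) : ℝ) + ((δ / K)⁻¹ + 3 / 2) =
        (K : ℝ) * N₀ + 1 + ((K : ℝ) * δ⁻¹ + 3 / 2) := by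
      push_cast; rw [inv_div, div_eq_mul_inv]
    rw [hcast] at hweak
    exact hweak
  -- let `K → ∞`
  have hlim : Sig ≤ ((N₀ : ℝ) + δ⁻¹) * A := by
    refine le_of_forall_le_add_div (C := 5 / 2 * A) (by positivity) fun K hK => ?_
    have hKr : (0 : ℝ) < K := by exact_mod_cast hK
    have := hmain K hK
    rw [← sub_nonneg] at this ⊢
    have hK' : ((K : ℝ) * N₀ + 1 + ((K : ℝ) * δ⁻¹ + 3 / 2)) * A - K * Sig =
        K * (((N₀ : ℝ) + δ⁻¹) * A + 5 / 2 * A / K - Sig) := by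
      field_simp; ring
    rw [hK'] at this
    have h2 := (mul_nonneg_iff_of_pos_left hKr).mp this
    linarith
  push_cast
  linarith [hlim]

end Hilbert


end Literature.NumberTheory.Sieve.LargeSieveMV

namespace Literature.NumberTheory.Sieve

open LargeSieve (e e_add_int farey_spacing)
open LargeSieveMV
open scoped FourierTransform

/-- **Discharge of parity.S33** (`Literature.NumberTheory.Sieve.large_sieve_inequality`): for complex `a_n` supported on
`M < n ≤ M + N`, `∑_{q ≤ Q} ∑_{b mod q, (b,q)=1} |∑_n a_n e(bn/q)|² ≤ (Q² + N − 1) ∑_n |a_n|²`.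
Proof: the Farey points of order `Q` are `Q⁻²`-spaced (`LargeSieve.farey_spacing`; Montgomery 1978,
(20)), so
`largeSieve_sharp` (Selberg's constant `N − 1 + δ⁻¹`, Montgomery 1978, Thm 3, obtained from
Montgomery–Vaughan's inequality by Cohen's dilation) applies with `δ = Q⁻²`; the cases `N = 0` and
`Q = 0` are trivial. This is exactly Iwaniec–Kowalski Thm 7.11; Montgomery–Vaughan 1973, Thm 1
verbatim gives `Q² + N`. [cite: Montgomery1978, Thm 3 and (20), p. 559;
MontgomeryVaughanMathematika1973, Thm 1; IwaniecKowalski2004, Thm 7.11] -/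
theorem large_sieve_inequality_holds : large_sieve_inequality := by
  intro a M N Q
  rcases Nat.eq_zero_or_pos N with hN | hN
  · subst hN; simp
  rcases Nat.eq_zero_or_pos Q with hQ | hQ
  · subst hQ
    rw [Finset.Icc_eq_empty (by norm_num), Finset.sum_empty]
    apply mul_nonneg
    · have : (1 : ℝ) ≤ N := by exact_mod_cast hN
      push_cast; linarith
    · exact Finset.sum_nonneg fun n _ => sq_nonneg _
  -- the index set of Farey fractions of order `Q`
  set S : Finset (Σ _ : ℕ, ℕ) := (Icc 1 Q).sigma fun q => (range q).filter (fun b => b.Coprime q)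
    with hS
  set x : S → ℝ := fun p => ((p.1.2 : ℕ) : ℝ) / ((p.1.1 : ℕ) : ℝ) with hx
  have hrewrite : ∑ q ∈ Icc 1 Q, ∑ b ∈ range q with b.Coprime q,
      ‖∑ n ∈ Ioc M (M + N), a n * (𝐞 ((b : ℝ) * n / q) : ℂ)‖ ^ 2 =
      ∑ p : S, ‖∑ n ∈ Ioc M (M + N), a n * e (n * x p)‖ ^ 2 := by
    have h1 : ∑ p : S, ‖∑ n ∈ Ioc M (M + N), a n * e (n * x p)‖ ^ 2 =
        ∑ p ∈ S, ‖∑ n ∈ Ioc M (M + N), a n * e (n * (((p.2 : ℕ) : ℝ) / ((p.1 : ℕ) : ℝ)))‖ ^ 2 :=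
      Finset.sum_coe_sort S (fun p =>
        ‖∑ n ∈ Ioc M (M + N), a n * e (n * (((p.2 : ℕ) : ℝ) / ((p.1 : ℕ) : ℝ)))‖ ^ 2)
    rw [h1, hS, Finset.sum_sigma]
    refine Finset.sum_congr rfl fun q _ => Finset.sum_congr rfl fun b _ => ?_
    congr 2
    refine Finset.sum_congr rfl fun n _ => ?_
    change a n * e ((b : ℝ) * n / q) = _
    congr 2
    ring
  rw [hrewrite]
  -- separation of the Farey points
  have hQr : (1 : ℝ) ≤ Q := by exact_mod_cast hQ
  have hδ : (0 : ℝ) < ((Q : ℝ) ^ 2)⁻¹ := by positivity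
  have hδ1 : ((Q : ℝ) ^ 2)⁻¹ ≤ 1 := inv_le_one_of_one_le₀ (by nlinarith)
  have hsep : ∀ p p' : S, p ≠ p' → ∀ m : ℤ, ((Q : ℝ) ^ 2)⁻¹ ≤ |x p - x p' - m| := by
    intro p p' hpp' m
    obtain ⟨⟨q, b⟩, hp⟩ := p
    obtain ⟨⟨q', b'⟩, hp'⟩ := p'
    simp only [hS, Finset.mem_sigma, Finset.mem_filter, Finset.mem_range] at hp hp'
    have hne : (⟨q, b⟩ : Σ _ : ℕ, ℕ) ≠ ⟨q', b'⟩ := fun h => hpp' (Subtype.ext h)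
    exact farey_spacing hp'.1 hp.1 hp'.2.1 hp.2.1 hp'.2.2 hp.2.2 (Ne.symm hne) m
  have hmain := largeSieve_sharp (ι := S) hδ hδ1 hsep a M N hN
  rw [inv_inv] at hmain
  linarith [hmain]

end Literature.NumberTheory.Sieve
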